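/-
Copyright: statement-level skeleton of a published paper (lit-balaban cell, Phase-2 proof seat p39 gen 5). No proof claims
beyond what the kernel checks below.
-/
import Literature.MathematicalPhysics.QuantumFieldTheory.Balaban1983to89.B4Thm110ZeroTorus
import Literature.MathematicalPhysics.QuantumFieldTheory.Balaban1983to89.B3GkZeroBoxPointwise

/-!
# B3 — T. Bałaban, *(Higgs)₂,₃ quantum fields in a finite volume. III. Renormalization*, CMP **88** (1983) 411–445
[Balaban1983Higgs3], p. 437 [PDF 27]: the printed inequality **|G^ξ_{j″}(0; y, y′)| ≦ O(1)e^{−δ₀|y−y′|}/|y − y′|** *"and the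
corresponding inequalities for derivatives"* — PROVED FOR THE ZERO-FIELD PROPAGATOR ON THE TORUS, i.e. for Bałaban's concrete
scalar torus tower `G^ε_k = G_k(T_ε, 0)` (`B1RG242Torus.tower`), every volume and every scale, by SUMMING THE TERMS OF [B4] (2.34)
OVER THE SCALES — the torus twin of this seat's `B3GkZeroBoxPointwise` (Neumann box)

statement-level skeleton of published theorems with citation tags; proofs where landed; nothing here is a claim about
the Yang–Mills mass gap

PDF held: `paper:balaban1983-higgs-2-3-quantum-fields-finite-volume` (journal page = PDF page + 410); p. 437 [PDF 27] read in the OCR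
text (`p0027.txt`); [B4] = T. Bałaban, *Regularity and decay of lattice Green's functions*, CMP **89** (1983) 571–597
[Balaban1983RegularityDecay], (2.34) p. 582 as quoted in the header of `B4Thm110ZeroTorus`.
Row **B3.Eq3.11-3.17** of `HOME/lit-balaban-r15/ROWS-B3.md` (fold owner r15): the p. 437 sentence *"Using the inequalities
|C^ξ(y − y′)| ≦ O(1)e^{−½|y−y′|}/|y − y′|, |G^ξ_{j″}(0; y, y′)| ≦ O(1)e^{−δ₀|y−y′|}/|y − y′|, and the corresponding inequalities for
derivatives, we can estimate (3.16) by a constant"* — here the `G^ξ_{j″}(0)`-inequalities ON THE TORUS `T^{(0)} = Site P 0`, the carrier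
on which (3.15)/(3.16)/(3.23) are typed (r15 `B3Sect3ScalarSelfEnergy`, p20 `B3Bound316`, this seat `B3Bound323`).  The paper's
`G_{j″}(0) = Σ_{j<j″}G_{(j)}(0)` ((2.6) p. 424 at zero field) takes its kernel bound from [Balaban1982Higgs1] Prop. 2.1 = [B4] Theorem;
the `|y − y′|^{−(d−2)}` short-distance law is exactly what the sum over the scales of the (2.34) terms produces.

INPUTS, BY NAME (p38 g4 `B4Thm110ZeroTorus`, nothing re-proved): the kernel-level (2.34) decompositions `G_apply_eq`
(`G^ε_k(x,x′) = ε²G_0^{unit}(x,x′) + Σ_{1≤j<k} a_j²(L^jε)² Σ_{y,y′}(G_j^{resc}Q_j^*)(x,y)C^{(j)}(y,y′)(Q_jG_j^{resc})(y′,x′)`) and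
`derivG_apply_eq` (one power of `L^jε` fewer), the three-kernel convolution `conv_bound`, the kernel inputs `KerBounds` /
`kerBounds_torus` ((2.35), (2.37), hypothesis-free and volume-uniform), `QkGrs_apply`, `derivG0unit_bound`, and p37/p16's
`B5Leaf237C0Torus.G0unit_decay`; the torus metric `B5Ineq137Torus.T` with `T_fine_fine`/`T_blk_le`; and this seat's real-analysis
lemma `B3GkZeroBoxPointwise.scaleSum_le` (`Σ_{j<k}(L^j)^{−p}e^{−δn/L^j} ≤ C·n^{−p}e^{−(δ/2)n/L^{k−1}}`).

WHAT IS PROVED.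
* §1 `term_entry_bound`: the `(x, x′)` ENTRY of one term of (2.34) (value form with `A = G_j^{resc}Q_j^*`, derivative form with
  `A = K1_j`): `|Σ_{y,y′}A(x,y)C^{(j)}(y,y′)(Q_jG_j^{resc})(y′,x′)| ≤ C³L^{−jd}K_d(δ/2)²e^{−(δ/2)|proj_j x − proj_j x′|_{T^{(j)}}}`
  (p38's `conv_bound`, the entry form of the inner step of `term_row_bound`).
* §2 `T_proj_ge'`, `exp_block_le`: the block distance dominates the fine one, `e^{−θ|proj x − proj x′|_{T^{(j)}}} ≤
  e^{2θ}e^{−θ|x−x′|_{T^{(0)}}/L^j}`.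
* §3 at one volume, under the kernel inputs (`KerBounds`, `hG0`): **`abs_G_entry_le`** (d ≥ 3):
  `|G^ε_k(x,x′)| ≤ c_val·ε²·|x−x′|_T^{−(d−2)}·e^{−m₁|x−x′|_T/L^{k−1}}`, `m₁ = min(δ₀/2, δ/4)`, and **`abs_derivG_entry_le`** (d ≥ 2):
  `|(∂^ε_μG^ε_k)(x,x′)| ≤ c_der·ε·|x−x′|_T^{−(d−1)}·e^{−m₁|x−x′|_T/L^{k−1}}` for `x′ ≠ x`, explicit `c_val`, `c_der` — the `j = 0` term by
  `n^pe^{−δ₀n/2} ≤ p!(2/δ₀)^p`, the terms `j ≥ 1` by §1–§2 and `scaleSum_le` with `(L^jε)²L^{−jd} = ε²(L^j)^{−(d−2)}`.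
* §4 **`gk_zero_torus_pointwise`** — HYPOTHESIS-FREE AND UNIFORM: for `d ≥ 3`, odd `L > 1`, `a > 0`, `m² ≥ 0` there are
  `δ₁, c₁ > 0` (functions of `d, L, a, m²` only) with, for EVERY volume `P = (d, L, m, K)`, every `1 ≤ k ≤ K` and all `x′ ≠ x`:
  `|G^ε_k(x,x′)| ≤ c₁ε²|x−x′|_T^{−(d−2)}e^{−δ₁ε|x−x′|_T}` and `|(∂^ε_μG^ε_k)(x,x′)| ≤ c₁ε|x−x′|_T^{−(d−1)}e^{−δ₁ε|x−x′|_T}`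
  (`L^{k−1}ε ≤ 1`); **`gk_zero_torus_pointwise_eta`**: the same in the print's `η^d`-normalisation `G^η = ε^{−d}G`, `dist = ε|x−x′|_T`:
  `|G^η_k(x,x′)| ≤ c₁·dist^{−(d−2)}e^{−δ₁dist}`, `|(∂^ε_μG^η_k)(x,x′)| ≤ c₁·dist^{−(d−1)}e^{−δ₁dist}` — at `d = 3` the printed
  `O(1)e^{−δ₀|y−y′|}/|y−y′|` and `1/|y−y′|²`.
HONEST SCOPE: `A = 0`, `U ≡ 1`, one component, Ω = the whole torus (the scope of `B4Thm110ZeroTorus`); sup torus distance in fine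
lattice units (`T`, the print's Euclidean `|y − y′|` ≥ it); forward `ε`-difference in the first variable (`deriv P 0 P.eps μ`);
existential constants depending on `d, L, a, m²`; value clause for `d ≥ 3` only (at `d = 2` the printed law is logarithmic and is not
claimed).  Mathlib + the cited tree files only; theorems only, no new definitions, no named facts; standard axioms.
Unit `lit-balaban-p39-g5` (Phase-2 proof seat p39, gen 5), HOME `run/shared/lean/pub/lit-balaban/`, 2026-08-21.
-/

namespace Literature.MathematicalPhysics.QuantumFieldTheory.Balaban1983to89.B3GkZeroTorusPointwise

open Matrix B1RG242Torus B5Display136Torus B5Leaf237C0Torus B4Ineq115Torus B5Ineq137Torus B4Ineq116Torus B4Thm110ZeroTorus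
open B3GkZeroBoxPointwise (scaleSum_le)

noncomputable section

variable (P : Params)

/-! ## 1. The entry of one term of (2.34) -/

/-- **THE `(x, x′)` ENTRY OF ONE TERM OF (2.34)** (value form `A = G_j^{resc}Q_j^*`, derivative form `A = K1_j`): if
`|A(z,y)| ≤ Ce^{−δ|proj_j z − y|_{T^{(j)}}}` and the kernel inputs (2.35)/(2.37) hold (`KerBounds`), then
`|Σ_{y,y′}A(x,y)C^{(j)}(y,y′)(Q_jG_j^{resc})(y′,x′)| ≤ C³·L^{−jd}·K_d(δ/2)²·e^{−(δ/2)|proj_j x − proj_j x′|_{T^{(j)}}}` (p38's `conv_bound`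
with `(Q_jG_j^{resc})(y′,x′) = L^{−jd}(G_j^{resc}Q_j^*)(x′,y′)`). [cite: Balaban1983RegularityDecay, (2.34)–(2.38) p.582;
Balaban1983Higgs3, (2.6) p.424, (2.10) p.426] -/
theorem term_entry_bound {a msq : ℝ} {k : ℕ} {C δ : ℝ} (hC : 0 ≤ C) (hδ : 0 < δ) (hK : KerBounds P a msq k C δ)
    {j : ℕ} (hj1 : 1 ≤ j) (hjk : j < k) (hkm : k ≤ P.m + P.K) (x x' : Site P 0) (A : Site P 0 → Site P j → ℝ)
    (hA : ∀ (z : Site P 0) (y : Site P j), |A z y| ≤ C * Real.exp (-(δ * T P j (Site.proj j j z) y))) :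
    |∑ y : Site P j, ∑ y' : Site P j, A x y * Crs P a msq j y y' * (Qk P j * Grs P a msq j) y' x'|
      ≤ C ^ 3 * (((P.L : ℝ) ^ j) ^ P.d)⁻¹ * B4Sect5Proof.latticeConst P.d (δ / 2) ^ 2 *
          Real.exp (-(δ / 2 * T P j (Site.proj j j x) (Site.proj j j x'))) := by
  have hj : j ≤ P.m + P.K := hjk.le.trans hkm
  have hw : 0 ≤ (((P.L : ℝ) ^ j) ^ P.d)⁻¹ := by positivity
  have h := conv_bound P hδ hC hC (mul_nonneg hw hC) (Site.proj j j x) (Site.proj j j x') (A x) (Crs P a msq j)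
    (fun y' => (Qk P j * Grs P a msq j) y' x') (hA x) (hK.crs j hj1 hjk) (fun y' => by
      rw [QkGrs_apply P hj, abs_mul, abs_of_nonneg hw, mul_assoc]
      exact mul_le_mul_of_nonneg_left (hK.gq j hj1 hjk x' y') hw)
  calc |∑ y : Site P j, ∑ y' : Site P j, A x y * Crs P a msq j y y' * (Qk P j * Grs P a msq j) y' x'|
      ≤ C * C * ((((P.L : ℝ) ^ j) ^ P.d)⁻¹ * C) * B4Sect5Proof.latticeConst P.d (δ / 2) ^ 2 *
          Real.exp (-(δ / 2 * T P j (Site.proj j j x) (Site.proj j j x'))) := h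
    _ = _ := by ring

/-! ## 2. Block distance versus fine distance -/

/-- The block distance dominates the fine distance up to the block diameter: `L^j·|proj x − proj x′|_{T^{(j)}} ≥ |x − x′|_{T^{(0)}} −
2(L^j − 1)` (the twin of p38's private `T_proj_ge`, from `T_blk_le`, `T_fine_fine` and the triangle inequality). [folklore]
[cite: Balaban1983RegularityDecay, (2.38)–(2.39) p.582] -/
theorem T_proj_ge' {j : ℕ} (hj : j ≤ P.m + P.K) (x x' : Site P 0) :
    T P 0 x x' - 2 * ((P.L : ℝ) ^ j - 1) ≤ (P.L : ℝ) ^ j * T P j (Site.proj j j x) (Site.proj j j x') := by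
  have h1 := T_blk_le P hj x
  have h2 := T_blk_le P hj x'
  rw [B5Leaf235Torus.blk_eq_proj hj] at h1 h2
  have h3 := T_fine_fine P hj (Site.proj j j x) (Site.proj j j x')
  have t1 := T_triangle P 0 x (fine P j (Site.proj j j x)) x'
  have t2 := T_triangle P 0 (fine P j (Site.proj j j x)) (fine P j (Site.proj j j x')) x'
  have t3 := T_symm P 0 (fine P j (Site.proj j j x')) x'
  linarith

/-- `e^{−θ|proj x − proj x′|_{T^{(j)}}} ≤ e^{2θ}·e^{−θ|x − x′|_{T^{(0)}}/L^j}` (`θ ≥ 0`): a decay in the block distance is a decay on the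
scale `L^j` in the fine distance. [cite: Balaban1983RegularityDecay, (2.38)–(2.39) p.582] -/
theorem exp_block_le {j : ℕ} (hj : j ≤ P.m + P.K) {θ : ℝ} (hθ : 0 ≤ θ) (x x' : Site P 0) :
    Real.exp (-(θ * T P j (Site.proj j j x) (Site.proj j j x'))) ≤
      Real.exp (2 * θ) * Real.exp (-(θ * T P 0 x x' / (P.L : ℝ) ^ j)) := by
  have hLj : 0 < (P.L : ℝ) ^ j := pow_pos P.cast_L_pos j
  have hge := T_proj_ge' P hj x x'
  rw [← Real.exp_add]
  apply Real.exp_le_exp.mpr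
  have hdiv : T P 0 x x' / (P.L : ℝ) ^ j ≤ T P j (Site.proj j j x) (Site.proj j j x') + 2 := by
    rw [div_le_iff₀ hLj]
    nlinarith
  rw [mul_div_assoc]
  nlinarith [mul_le_mul_of_nonneg_left hdiv hθ]

/-! ## 3. The pointwise bounds at one volume, from the kernel inputs -/

/-- kernel: `u^p e^{−cu} ≤ p!/c^p` for `u ≥ 0`, `c > 0` (from `(cu)^p/p! ≤ e^{cu}`). [folklore] -/
private theorem pow_mul_exp_neg_le' {c u : ℝ} (hc : 0 < c) (hu : 0 ≤ u) (p : ℕ) :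
    u ^ p * Real.exp (-(c * u)) ≤ (p.factorial : ℝ) / c ^ p := by
  have h := Real.pow_div_factorial_le_exp (c * u) (by positivity) p
  have hp : (0 : ℝ) < p.factorial := by exact_mod_cast Nat.factorial_pos p
  have hcp : 0 < c ^ p := pow_pos hc p
  rw [div_le_iff₀ hp, mul_pow] at h
  rw [Real.exp_neg, le_div_iff₀ hcp]
  have hE := Real.exp_pos (c * u)
  calc u ^ p * (Real.exp (c * u))⁻¹ * c ^ p = (c ^ p * u ^ p) / Real.exp (c * u) := by
        field_simp
    _ ≤ (Real.exp (c * u) * p.factorial) / Real.exp (c * u) := by gcongr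
    _ = p.factorial := by field_simp

/-- kernel: the `j = 0` profile — `e^{−δ₀n} ≤ p!(δ₀/2)^{−p}·n^{−p}·e^{−(δ₀/2)n}` for `n > 0`. [folklore] -/
private theorem exp_le_inv_pow_mul {δ₀ n : ℝ} (hδ₀ : 0 < δ₀) (hn : 0 < n) (p : ℕ) :
    Real.exp (-(δ₀ * n)) ≤ (p.factorial : ℝ) / (δ₀ / 2) ^ p * n⁻¹ ^ p * Real.exp (-(δ₀ / 2 * n)) := by
  have h := pow_mul_exp_neg_le' (show 0 < δ₀ / 2 by positivity) hn.le p
  have hnp : 0 < n ^ p := pow_pos hn p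
  have hsplit : Real.exp (-(δ₀ * n)) = Real.exp (-(δ₀ / 2 * n)) * Real.exp (-(δ₀ / 2 * n)) := by
    rw [← Real.exp_add]; congr 1; ring
  rw [hsplit]
  refine mul_le_mul_of_nonneg_right ?_ (Real.exp_pos _).le
  rw [inv_pow]
  calc Real.exp (-(δ₀ / 2 * n)) = (n ^ p)⁻¹ * (n ^ p * Real.exp (-(δ₀ / 2 * n))) := by
        rw [← mul_assoc, inv_mul_cancel₀ hnp.ne', one_mul]
    _ ≤ (n ^ p)⁻¹ * ((p.factorial : ℝ) / (δ₀ / 2) ^ p) := mul_le_mul_of_nonneg_left h (by positivity)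
    _ = _ := by ring

/-- kernel: the scale factors of one term — `(L^jε)²·L^{−jd} = ε²·(L^j)^{−(d−2)}` (`d ≥ 2`). [folklore] -/
private theorem spacing_sq_mul_weight {j : ℕ} (hd : 2 ≤ P.d) :
    P.spacing j ^ 2 * (((P.L : ℝ) ^ j) ^ P.d)⁻¹ = P.eps ^ 2 * ((P.L : ℝ) ^ j)⁻¹ ^ (P.d - 2) := by
  have hLj : (P.L : ℝ) ^ j ≠ 0 := (pow_pos P.cast_L_pos j).ne'
  have hsplit : ((P.L : ℝ) ^ j) ^ P.d = ((P.L : ℝ) ^ j) ^ (P.d - 2) * ((P.L : ℝ) ^ j) ^ 2 := by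
    rw [← pow_add]; congr 1; omega
  rw [hsplit, inv_pow]
  unfold Params.spacing
  field_simp

/-- kernel: `(L^jε)·L^{−jd} = ε·(L^j)^{−(d−1)}` (`d ≥ 1`). [folklore] -/
private theorem spacing_mul_weight {j : ℕ} (hd : 1 ≤ P.d) :
    P.spacing j * (((P.L : ℝ) ^ j) ^ P.d)⁻¹ = P.eps * ((P.L : ℝ) ^ j)⁻¹ ^ (P.d - 1) := by
  have hLj : (P.L : ℝ) ^ j ≠ 0 := (pow_pos P.cast_L_pos j).ne'
  have hsplit : ((P.L : ℝ) ^ j) ^ P.d = ((P.L : ℝ) ^ j) ^ (P.d - 1) * ((P.L : ℝ) ^ j) ^ 1 := by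
    rw [← pow_add]; congr 1; omega
  rw [hsplit, inv_pow, pow_one]
  unfold Params.spacing
  field_simp

/-- kernel: the torus distance of two distinct fine sites is positive. [folklore] -/
private theorem T_pos_of_ne {x x' : Site P 0} (hne : x' ≠ x) : 0 < T P 0 x x' := by
  rcases (T_nonneg P 0 x x').lt_or_eq with h | h
  · exact h
  · exact absurd (eq_of_T_eq_zero (P := P) h.symm).symm hne

/-- kernel: for `k ≤ K`, `n/L^{k−1} ≤ n` and `εn ≤ n/L^{k−1}` (`L^{k−1} ≥ 1`, `L^{k−1}ε ≤ 1`), `n ≥ 0`. [folklore] -/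
private theorem scale_window {k : ℕ} (hkK : k ≤ P.K) {n : ℝ} (hn : 0 ≤ n) :
    n / (P.L : ℝ) ^ (k - 1) ≤ n ∧ P.eps * n ≤ n / (P.L : ℝ) ^ (k - 1) := by
  have hL1 : (1 : ℝ) < P.L := one_lt_cast_L P
  have hLk : 1 ≤ (P.L : ℝ) ^ (k - 1) := one_le_pow₀ hL1.le
  have hLk0 : 0 < (P.L : ℝ) ^ (k - 1) := by positivity
  constructor
  · rw [div_le_iff₀ hLk0]; nlinarith
  · have hs : P.spacing (k - 1) ≤ 1 := by
      rw [← P.spacing_K]; exact spacing_le_spacing P (by omega)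
    unfold Params.spacing at hs
    rw [le_div_iff₀ hLk0]
    nlinarith

/-- kernel: the sum over the scales `1 ≤ j < k` of the term profiles is dominated by the full scale sum, hence by `scaleSum_le`:
`Σ_{1≤j<k}(L^j)^{−p}e^{−θn/L^j} ≤ C_s(L,θ,p)·n^{−p}·e^{−(θ/2)n/L^{k−1}}`. [cite: Balaban1983Higgs3, (2.6) p.424 with (2.10) p.426] -/
private theorem sum_Ico_profile_le {θ n : ℝ} (hθ : 0 < θ) (hn : 0 < n) {p : ℕ} (hp : 1 ≤ p) (k : ℕ) :
    ∑ j ∈ Finset.Ico 1 k, ((P.L : ℝ) ^ j)⁻¹ ^ p * Real.exp (-(θ * n / (P.L : ℝ) ^ j)) ≤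
      ((P.L : ℝ) / ((P.L : ℝ) - 1) * Real.exp (θ / 2) +
          (p.factorial : ℝ) / (θ / 2) ^ p * (1 - Real.exp (-(θ / 2 * ((P.L : ℝ) - 1))))⁻¹) *
        n⁻¹ ^ p * Real.exp (-(θ / 2 * (n / (P.L : ℝ) ^ (k - 1)))) := by
  have hL1 : (1 : ℝ) < P.L := one_lt_cast_L P
  refine le_trans ?_ (scaleSum_le hL1 hθ hp k hn)
  refine Finset.sum_le_sum_of_subset_of_nonneg (fun j hj => ?_) (fun j _ _ => by positivity)
  exact Finset.mem_range.mpr (Finset.mem_Ico.mp hj).2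

/-- **THE VALUE BOUND AT ONE VOLUME, FROM THE KERNEL INPUTS** (`d ≥ 3`, `1 ≤ k ≤ K`, `k ≤ m + K`): under (2.35)/(2.37) at the
levels `1 ≤ j < k` (`KerBounds`) and the `C^{(0)}` kernel bound `|G_0^{unit}(x,x′)| ≤ C₀e^{−δ₀|x−x′|_T}`, for all `x′ ≠ x`,
`|G^ε_k(x,x′)| ≤ c_val·ε²·|x−x′|_T^{−(d−2)}·e^{−min(δ₀/2,δ/4)·|x−x′|_T/L^{k−1}}` with the explicit `c_val(d, L, a, C, δ, C₀, δ₀)` of the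
statement: (2.34) entrywise (`G_apply_eq`), the `j = 0` term by `n^{d−2}e^{−δ₀n/2} ≤ (d−2)!(2/δ₀)^{d−2}`, the terms `j ≥ 1` by
`term_entry_bound` + `exp_block_le` + `(L^jε)²L^{−jd} = ε²(L^j)^{−(d−2)}` and the scale sum `scaleSum_le`.
[cite: Balaban1983Higgs3, p.437 («|G^ξ_{j″}(0;y,y′)| ≦ O(1)e^{−δ₀|y−y′|}/|y−y′|»), (2.6) p.424, (2.10) p.426;
Balaban1983RegularityDecay, (2.34)–(2.39) p.582] -/
theorem abs_G_entry_le {a msq : ℝ} (ha : 0 < a) (hm : 0 ≤ msq) (hd : 3 ≤ P.d) {k : ℕ} (hk1 : 1 ≤ k) (hkK : k ≤ P.K)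
    (hkm : k ≤ P.m + P.K) {C δ C₀ δ₀ : ℝ} (hC : 0 ≤ C) (hδ : 0 < δ) (hC₀ : 0 ≤ C₀) (hδ₀ : 0 < δ₀)
    (hK : KerBounds P a msq k C δ)
    (hG0 : ∀ x x' : Site P 0, |G0unit P a msq x x'| ≤ C₀ * Real.exp (-(δ₀ * T P 0 x x')))
    {x x' : Site P 0} (hne : x' ≠ x) :
    |(tower P a msq).G k x x'| ≤
      (C₀ * (((P.d - 2).factorial : ℝ) / (δ₀ / 2) ^ (P.d - 2)) +
          a ^ 2 * (C ^ 3 * B4Sect5Proof.latticeConst P.d (δ / 2) ^ 2 * Real.exp (2 * (δ / 2))) *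
            ((P.L : ℝ) / ((P.L : ℝ) - 1) * Real.exp (δ / 2 / 2) +
              ((P.d - 2).factorial : ℝ) / (δ / 2 / 2) ^ (P.d - 2) *
                (1 - Real.exp (-(δ / 2 / 2 * ((P.L : ℝ) - 1))))⁻¹)) *
        (P.eps ^ 2 * (T P 0 x x')⁻¹ ^ (P.d - 2) *
          Real.exp (-(min (δ₀ / 2) (δ / 4) * (T P 0 x x' / (P.L : ℝ) ^ (k - 1))))) := by
  have hL1 : (1 : ℝ) < P.L := one_lt_cast_L P
  set n : ℝ := T P 0 x x' with hndef
  have hn : 0 < n := T_pos_of_ne P hne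
  set p : ℕ := P.d - 2 with hpdef
  have hp : 1 ≤ p := by omega
  set m₁ : ℝ := min (δ₀ / 2) (δ / 4) with hm₁
  have hm₁0 : 0 ≤ m₁ := le_min (by positivity) (by positivity)
  set E : ℝ := Real.exp (-(m₁ * (n / (P.L : ℝ) ^ (k - 1)))) with hE
  have hE0 : 0 < E := Real.exp_pos _
  obtain ⟨hwin1, -⟩ := scale_window P hkK hn.le
  have hnL0 : 0 ≤ n / (P.L : ℝ) ^ (k - 1) := by positivity
  have hK0 : 0 ≤ B4Sect5Proof.latticeConst P.d (δ / 2) := B4Sect5Proof.latticeConst_nonneg _ (by positivity)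
  set Cs : ℝ := (P.L : ℝ) / ((P.L : ℝ) - 1) * Real.exp (δ / 2 / 2) +
      (p.factorial : ℝ) / (δ / 2 / 2) ^ p * (1 - Real.exp (-(δ / 2 / 2 * ((P.L : ℝ) - 1))))⁻¹ with hCs
  -- the `j = 0` term
  have h0 : |P.eps ^ 2 * G0unit P a msq x x'| ≤
      C₀ * ((p.factorial : ℝ) / (δ₀ / 2) ^ p) * (P.eps ^ 2 * n⁻¹ ^ p * E) := by
    have h1 := (hG0 x x').trans (mul_le_mul_of_nonneg_left (exp_le_inv_pow_mul hδ₀ hn p) hC₀)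
    have h2 : Real.exp (-(δ₀ / 2 * n)) ≤ E := by
      rw [hE]; apply Real.exp_le_exp.mpr
      have : m₁ * (n / (P.L : ℝ) ^ (k - 1)) ≤ δ₀ / 2 * n :=
        mul_le_mul (min_le_left _ _) hwin1 hnL0 (by positivity)
      linarith
    rw [abs_mul, abs_of_nonneg (by positivity : (0 : ℝ) ≤ P.eps ^ 2)]
    calc P.eps ^ 2 * |G0unit P a msq x x'|
        ≤ P.eps ^ 2 * (C₀ * ((p.factorial : ℝ) / (δ₀ / 2) ^ p * n⁻¹ ^ p * Real.exp (-(δ₀ / 2 * n)))) :=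
          mul_le_mul_of_nonneg_left h1 (by positivity)
      _ ≤ P.eps ^ 2 * (C₀ * ((p.factorial : ℝ) / (δ₀ / 2) ^ p * n⁻¹ ^ p * E)) := by gcongr
      _ = _ := by ring
  -- the terms `j ≥ 1`
  have hj : ∀ j ∈ Finset.Ico 1 k,
      |B1.aSeq a P.L j ^ 2 * P.spacing j ^ 2 *
          ∑ y : Site P j, ∑ y' : Site P j,
            (Grs P a msq j * Qks P j) x y * Crs P a msq j y y' * (Qk P j * Grs P a msq j) y' x'|
        ≤ a ^ 2 * (C ^ 3 * B4Sect5Proof.latticeConst P.d (δ / 2) ^ 2 * Real.exp (2 * (δ / 2))) *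
            (P.eps ^ 2 * (((P.L : ℝ) ^ j)⁻¹ ^ p * Real.exp (-(δ / 2 * n / (P.L : ℝ) ^ j)))) := by
    intro j hjm
    obtain ⟨hj1, hjk⟩ := Finset.mem_Ico.mp hjm
    have hjm' : j ≤ P.m + P.K := hjk.le.trans hkm
    have ht := term_entry_bound P hC hδ hK hj1 hjk hkm x x' (fun z y => (Grs P a msq j * Qks P j) z y) (hK.gq j hj1 hjk)
    have hb := exp_block_le P hjm' (show (0 : ℝ) ≤ δ / 2 by positivity) x x'
    have haj : B1.aSeq a P.L j ^ 2 ≤ a ^ 2 := by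
      have := B5Leaf235Torus.abs_aSeq_le ha hL1 j
      rw [← sq_abs]; exact pow_le_pow_left₀ (abs_nonneg _) this 2
    have hw : 0 ≤ (((P.L : ℝ) ^ j) ^ P.d)⁻¹ := by positivity
    have hsw := spacing_sq_mul_weight P (j := j) (by omega)
    rw [abs_mul, abs_mul, abs_of_nonneg (sq_nonneg _), abs_of_nonneg (sq_nonneg _)]
    calc B1.aSeq a P.L j ^ 2 * P.spacing j ^ 2 *
          |∑ y : Site P j, ∑ y' : Site P j,
            (Grs P a msq j * Qks P j) x y * Crs P a msq j y y' * (Qk P j * Grs P a msq j) y' x'|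
        ≤ a ^ 2 * P.spacing j ^ 2 * (C ^ 3 * (((P.L : ℝ) ^ j) ^ P.d)⁻¹ * B4Sect5Proof.latticeConst P.d (δ / 2) ^ 2 *
            (Real.exp (2 * (δ / 2)) * Real.exp (-(δ / 2 * n / (P.L : ℝ) ^ j)))) := by
          refine mul_le_mul (mul_le_mul_of_nonneg_right haj (sq_nonneg _)) (ht.trans ?_) (abs_nonneg _) (by positivity)
          exact mul_le_mul_of_nonneg_left hb (by positivity)
      _ = a ^ 2 * (C ^ 3 * B4Sect5Proof.latticeConst P.d (δ / 2) ^ 2 * Real.exp (2 * (δ / 2))) *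
            ((P.spacing j ^ 2 * (((P.L : ℝ) ^ j) ^ P.d)⁻¹) * Real.exp (-(δ / 2 * n / (P.L : ℝ) ^ j))) := by ring
      _ = _ := by rw [hsw]; ring
  -- their sum over the scales
  have hsum : ∑ j ∈ Finset.Ico 1 k,
      |B1.aSeq a P.L j ^ 2 * P.spacing j ^ 2 *
          ∑ y : Site P j, ∑ y' : Site P j,
            (Grs P a msq j * Qks P j) x y * Crs P a msq j y y' * (Qk P j * Grs P a msq j) y' x'|
        ≤ a ^ 2 * (C ^ 3 * B4Sect5Proof.latticeConst P.d (δ / 2) ^ 2 * Real.exp (2 * (δ / 2))) * Cs *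
            (P.eps ^ 2 * n⁻¹ ^ p * E) := by
    have hS := sum_Ico_profile_le P (show 0 < δ / 2 by positivity) hn hp k
    have h2 : Real.exp (-(δ / 2 / 2 * (n / (P.L : ℝ) ^ (k - 1)))) ≤ E := by
      rw [hE]; apply Real.exp_le_exp.mpr
      have : m₁ * (n / (P.L : ℝ) ^ (k - 1)) ≤ δ / 2 / 2 * (n / (P.L : ℝ) ^ (k - 1)) :=
        mul_le_mul_of_nonneg_right ((min_le_right _ _).trans (by linarith)) hnL0
      linarith
    have hCs0 : 0 ≤ Cs := by
      have hL0 : 0 < (P.L : ℝ) - 1 := by linarith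
      have hq : 0 < 1 - Real.exp (-(δ / 2 / 2 * ((P.L : ℝ) - 1))) := by
        have : Real.exp (-(δ / 2 / 2 * ((P.L : ℝ) - 1))) < 1 :=
          Real.exp_lt_one_iff.2 (by nlinarith)
        linarith
      rw [hCs]; positivity
    calc ∑ j ∈ Finset.Ico 1 k,
          |B1.aSeq a P.L j ^ 2 * P.spacing j ^ 2 *
            ∑ y : Site P j, ∑ y' : Site P j,
              (Grs P a msq j * Qks P j) x y * Crs P a msq j y y' * (Qk P j * Grs P a msq j) y' x'|
        ≤ ∑ j ∈ Finset.Ico 1 k, a ^ 2 * (C ^ 3 * B4Sect5Proof.latticeConst P.d (δ / 2) ^ 2 * Real.exp (2 * (δ / 2))) *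
            (P.eps ^ 2 * (((P.L : ℝ) ^ j)⁻¹ ^ p * Real.exp (-(δ / 2 * n / (P.L : ℝ) ^ j)))) := Finset.sum_le_sum hj
      _ = a ^ 2 * (C ^ 3 * B4Sect5Proof.latticeConst P.d (δ / 2) ^ 2 * Real.exp (2 * (δ / 2))) * P.eps ^ 2 *
            ∑ j ∈ Finset.Ico 1 k, ((P.L : ℝ) ^ j)⁻¹ ^ p * Real.exp (-(δ / 2 * n / (P.L : ℝ) ^ j)) := by
          rw [Finset.mul_sum]
          exact Finset.sum_congr rfl fun j _ => by ring
      _ ≤ a ^ 2 * (C ^ 3 * B4Sect5Proof.latticeConst P.d (δ / 2) ^ 2 * Real.exp (2 * (δ / 2))) * P.eps ^ 2 *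
            (Cs * n⁻¹ ^ p * Real.exp (-(δ / 2 / 2 * (n / (P.L : ℝ) ^ (k - 1))))) :=
          mul_le_mul_of_nonneg_left hS (by positivity)
      _ ≤ a ^ 2 * (C ^ 3 * B4Sect5Proof.latticeConst P.d (δ / 2) ^ 2 * Real.exp (2 * (δ / 2))) * P.eps ^ 2 *
            (Cs * n⁻¹ ^ p * E) := by
          refine mul_le_mul_of_nonneg_left ?_ (by positivity)
          exact mul_le_mul_of_nonneg_left h2 (by positivity)
      _ = _ := by ring
  -- assemble along (2.34)
  rw [G_apply_eq P ha hm hk1 x x']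
  calc |P.eps ^ 2 * G0unit P a msq x x' +
        ∑ j ∈ Finset.Ico 1 k, B1.aSeq a P.L j ^ 2 * P.spacing j ^ 2 *
          ∑ y : Site P j, ∑ y' : Site P j,
            (Grs P a msq j * Qks P j) x y * Crs P a msq j y y' * (Qk P j * Grs P a msq j) y' x'|
      ≤ |P.eps ^ 2 * G0unit P a msq x x'| +
        ∑ j ∈ Finset.Ico 1 k, |B1.aSeq a P.L j ^ 2 * P.spacing j ^ 2 *
          ∑ y : Site P j, ∑ y' : Site P j,
            (Grs P a msq j * Qks P j) x y * Crs P a msq j y y' * (Qk P j * Grs P a msq j) y' x'| :=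
        (abs_add_le _ _).trans (add_le_add le_rfl (Finset.abs_sum_le_sum_abs _ _))
    _ ≤ C₀ * ((p.factorial : ℝ) / (δ₀ / 2) ^ p) * (P.eps ^ 2 * n⁻¹ ^ p * E) +
        a ^ 2 * (C ^ 3 * B4Sect5Proof.latticeConst P.d (δ / 2) ^ 2 * Real.exp (2 * (δ / 2))) * Cs *
            (P.eps ^ 2 * n⁻¹ ^ p * E) := add_le_add h0 hsum
    _ = _ := by rw [hCs]; ring

/-- **THE DERIVATIVE BOUND AT ONE VOLUME, FROM THE KERNEL INPUTS** (`d ≥ 2`, `1 ≤ k ≤ K`, `k ≤ m + K`): under `KerBounds` (with the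
(2.35) second quantity for `K1_j`) and the `C^{(0)}` kernel bound, for all `x′ ≠ x` and every direction `μ`,
`|(∂^ε_μG^ε_k)(x,x′)| ≤ c_der·ε·|x−x′|_T^{−(d−1)}·e^{−min(δ₀/2,δ/4)·|x−x′|_T/L^{k−1}}` — one power of `L^jε` fewer per term
(`derivG_apply_eq`, B4 (2.38)), hence one power of `|x−x′|` more: *"the corresponding inequalities for derivatives"*.
[cite: Balaban1983Higgs3, p.437 («the corresponding inequalities for derivatives»), (2.10) p.426 («for each differentiation, there is
an additional factor (L^jη)^{−1}»); Balaban1983RegularityDecay, (2.34), (2.38) p.582] -/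
theorem abs_derivG_entry_le {a msq : ℝ} (ha : 0 < a) (hm : 0 ≤ msq) (hd : 2 ≤ P.d) {k : ℕ} (hk1 : 1 ≤ k) (hkK : k ≤ P.K)
    (hkm : k ≤ P.m + P.K) {C δ C₀ δ₀ : ℝ} (hC : 0 ≤ C) (hδ : 0 < δ) (hC₀ : 0 ≤ C₀) (hδ₀ : 0 < δ₀)
    (hK : KerBounds P a msq k C δ)
    (hG0 : ∀ x x' : Site P 0, |G0unit P a msq x x'| ≤ C₀ * Real.exp (-(δ₀ * T P 0 x x')))
    (μ : Fin P.d) {x x' : Site P 0} (hne : x' ≠ x) :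
    |(deriv P 0 P.eps μ * (tower P a msq).G k) x x'| ≤
      (2 * C₀ * Real.exp δ₀ * (((P.d - 1).factorial : ℝ) / (δ₀ / 2) ^ (P.d - 1)) +
          a ^ 2 * (C ^ 3 * B4Sect5Proof.latticeConst P.d (δ / 2) ^ 2 * Real.exp (2 * (δ / 2))) *
            ((P.L : ℝ) / ((P.L : ℝ) - 1) * Real.exp (δ / 2 / 2) +
              ((P.d - 1).factorial : ℝ) / (δ / 2 / 2) ^ (P.d - 1) *
                (1 - Real.exp (-(δ / 2 / 2 * ((P.L : ℝ) - 1))))⁻¹)) *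
        (P.eps * (T P 0 x x')⁻¹ ^ (P.d - 1) *
          Real.exp (-(min (δ₀ / 2) (δ / 4) * (T P 0 x x' / (P.L : ℝ) ^ (k - 1))))) := by
  have hL1 : (1 : ℝ) < P.L := one_lt_cast_L P
  have hε0 : 0 < P.eps := P.eps_pos
  set n : ℝ := T P 0 x x' with hndef
  have hn : 0 < n := T_pos_of_ne P hne
  set q : ℕ := P.d - 1 with hqdef
  have hq : 1 ≤ q := by omega
  set m₁ : ℝ := min (δ₀ / 2) (δ / 4) with hm₁
  have hm₁0 : 0 ≤ m₁ := le_min (by positivity) (by positivity)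
  set E : ℝ := Real.exp (-(m₁ * (n / (P.L : ℝ) ^ (k - 1)))) with hE
  have hE0 : 0 < E := Real.exp_pos _
  obtain ⟨hwin1, -⟩ := scale_window P hkK hn.le
  have hnL0 : 0 ≤ n / (P.L : ℝ) ^ (k - 1) := by positivity
  have hK0 : 0 ≤ B4Sect5Proof.latticeConst P.d (δ / 2) := B4Sect5Proof.latticeConst_nonneg _ (by positivity)
  set Cs : ℝ := (P.L : ℝ) / ((P.L : ℝ) - 1) * Real.exp (δ / 2 / 2) +
      (q.factorial : ℝ) / (δ / 2 / 2) ^ q * (1 - Real.exp (-(δ / 2 / 2 * ((P.L : ℝ) - 1))))⁻¹ with hCs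
  -- the `j = 0` term
  have h0 : |P.eps * (deriv P 0 1 μ * G0unit P a msq) x x'| ≤
      2 * C₀ * Real.exp δ₀ * ((q.factorial : ℝ) / (δ₀ / 2) ^ q) * (P.eps * n⁻¹ ^ q * E) := by
    have hD := derivG0unit_bound P hC₀ hδ₀ hG0 μ x x'
    have h1 := hD.trans (mul_le_mul_of_nonneg_left (exp_le_inv_pow_mul hδ₀ hn q) (by positivity))
    have h2 : Real.exp (-(δ₀ / 2 * n)) ≤ E := by
      rw [hE]; apply Real.exp_le_exp.mpr
      have : m₁ * (n / (P.L : ℝ) ^ (k - 1)) ≤ δ₀ / 2 * n :=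
        mul_le_mul (min_le_left _ _) hwin1 hnL0 (by positivity)
      linarith
    rw [abs_mul, abs_of_nonneg hε0.le]
    calc P.eps * |(deriv P 0 1 μ * G0unit P a msq) x x'|
        ≤ P.eps * (2 * C₀ * Real.exp δ₀ * ((q.factorial : ℝ) / (δ₀ / 2) ^ q * n⁻¹ ^ q * Real.exp (-(δ₀ / 2 * n)))) :=
          mul_le_mul_of_nonneg_left h1 hε0.le
      _ ≤ P.eps * (2 * C₀ * Real.exp δ₀ * ((q.factorial : ℝ) / (δ₀ / 2) ^ q * n⁻¹ ^ q * E)) := by gcongr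
      _ = _ := by ring
  -- the terms `j ≥ 1`
  have hj : ∀ j ∈ Finset.Ico 1 k,
      |B1.aSeq a P.L j ^ 2 * P.spacing j *
          ∑ y : Site P j, ∑ y' : Site P j,
            K1 P a msq j μ x ⟨j, y⟩ * Crs P a msq j y y' * (Qk P j * Grs P a msq j) y' x'|
        ≤ a ^ 2 * (C ^ 3 * B4Sect5Proof.latticeConst P.d (δ / 2) ^ 2 * Real.exp (2 * (δ / 2))) *
            (P.eps * (((P.L : ℝ) ^ j)⁻¹ ^ q * Real.exp (-(δ / 2 * n / (P.L : ℝ) ^ j)))) := by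
    intro j hjm
    obtain ⟨hj1, hjk⟩ := Finset.mem_Ico.mp hjm
    have hjm' : j ≤ P.m + P.K := hjk.le.trans hkm
    have ht := term_entry_bound P hC hδ hK hj1 hjk hkm x x' (fun z y => K1 P a msq j μ z ⟨j, y⟩) (hK.k1 j hj1 hjk μ)
    have hb := exp_block_le P hjm' (show (0 : ℝ) ≤ δ / 2 by positivity) x x'
    have haj : B1.aSeq a P.L j ^ 2 ≤ a ^ 2 := by
      have := B5Leaf235Torus.abs_aSeq_le ha hL1 j
      rw [← sq_abs]; exact pow_le_pow_left₀ (abs_nonneg _) this 2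
    have hsp0 : 0 ≤ P.spacing j := (P.spacing_pos j).le
    have hsw := spacing_mul_weight P (j := j) (by omega)
    rw [abs_mul, abs_mul, abs_of_nonneg (sq_nonneg _), abs_of_nonneg hsp0]
    calc B1.aSeq a P.L j ^ 2 * P.spacing j *
          |∑ y : Site P j, ∑ y' : Site P j,
            K1 P a msq j μ x ⟨j, y⟩ * Crs P a msq j y y' * (Qk P j * Grs P a msq j) y' x'|
        ≤ a ^ 2 * P.spacing j * (C ^ 3 * (((P.L : ℝ) ^ j) ^ P.d)⁻¹ * B4Sect5Proof.latticeConst P.d (δ / 2) ^ 2 *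
            (Real.exp (2 * (δ / 2)) * Real.exp (-(δ / 2 * n / (P.L : ℝ) ^ j)))) := by
          refine mul_le_mul (mul_le_mul_of_nonneg_right haj hsp0) (ht.trans ?_) (abs_nonneg _) (by positivity)
          exact mul_le_mul_of_nonneg_left hb (by positivity)
      _ = a ^ 2 * (C ^ 3 * B4Sect5Proof.latticeConst P.d (δ / 2) ^ 2 * Real.exp (2 * (δ / 2))) *
            ((P.spacing j * (((P.L : ℝ) ^ j) ^ P.d)⁻¹) * Real.exp (-(δ / 2 * n / (P.L : ℝ) ^ j))) := by ring
      _ = _ := by rw [hsw]; ring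
  -- their sum over the scales
  have hsum : ∑ j ∈ Finset.Ico 1 k,
      |B1.aSeq a P.L j ^ 2 * P.spacing j *
          ∑ y : Site P j, ∑ y' : Site P j,
            K1 P a msq j μ x ⟨j, y⟩ * Crs P a msq j y y' * (Qk P j * Grs P a msq j) y' x'|
        ≤ a ^ 2 * (C ^ 3 * B4Sect5Proof.latticeConst P.d (δ / 2) ^ 2 * Real.exp (2 * (δ / 2))) * Cs *
            (P.eps * n⁻¹ ^ q * E) := by
    have hS := sum_Ico_profile_le P (show 0 < δ / 2 by positivity) hn hq k
    have h2 : Real.exp (-(δ / 2 / 2 * (n / (P.L : ℝ) ^ (k - 1)))) ≤ E := by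
      rw [hE]; apply Real.exp_le_exp.mpr
      have : m₁ * (n / (P.L : ℝ) ^ (k - 1)) ≤ δ / 2 / 2 * (n / (P.L : ℝ) ^ (k - 1)) :=
        mul_le_mul_of_nonneg_right ((min_le_right _ _).trans (by linarith)) hnL0
      linarith
    have hCs0 : 0 ≤ Cs := by
      have hL0 : 0 < (P.L : ℝ) - 1 := by linarith
      have hq' : 0 < 1 - Real.exp (-(δ / 2 / 2 * ((P.L : ℝ) - 1))) := by
        have : Real.exp (-(δ / 2 / 2 * ((P.L : ℝ) - 1))) < 1 :=
          Real.exp_lt_one_iff.2 (by nlinarith)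
        linarith
      rw [hCs]; positivity
    calc ∑ j ∈ Finset.Ico 1 k,
          |B1.aSeq a P.L j ^ 2 * P.spacing j *
            ∑ y : Site P j, ∑ y' : Site P j,
              K1 P a msq j μ x ⟨j, y⟩ * Crs P a msq j y y' * (Qk P j * Grs P a msq j) y' x'|
        ≤ ∑ j ∈ Finset.Ico 1 k, a ^ 2 * (C ^ 3 * B4Sect5Proof.latticeConst P.d (δ / 2) ^ 2 * Real.exp (2 * (δ / 2))) *
            (P.eps * (((P.L : ℝ) ^ j)⁻¹ ^ q * Real.exp (-(δ / 2 * n / (P.L : ℝ) ^ j)))) := Finset.sum_le_sum hj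
      _ = a ^ 2 * (C ^ 3 * B4Sect5Proof.latticeConst P.d (δ / 2) ^ 2 * Real.exp (2 * (δ / 2))) * P.eps *
            ∑ j ∈ Finset.Ico 1 k, ((P.L : ℝ) ^ j)⁻¹ ^ q * Real.exp (-(δ / 2 * n / (P.L : ℝ) ^ j)) := by
          rw [Finset.mul_sum]
          exact Finset.sum_congr rfl fun j _ => by ring
      _ ≤ a ^ 2 * (C ^ 3 * B4Sect5Proof.latticeConst P.d (δ / 2) ^ 2 * Real.exp (2 * (δ / 2))) * P.eps *
            (Cs * n⁻¹ ^ q * Real.exp (-(δ / 2 / 2 * (n / (P.L : ℝ) ^ (k - 1))))) :=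
          mul_le_mul_of_nonneg_left hS (by positivity)
      _ ≤ a ^ 2 * (C ^ 3 * B4Sect5Proof.latticeConst P.d (δ / 2) ^ 2 * Real.exp (2 * (δ / 2))) * P.eps *
            (Cs * n⁻¹ ^ q * E) := by
          refine mul_le_mul_of_nonneg_left ?_ (by positivity)
          exact mul_le_mul_of_nonneg_left h2 (by positivity)
      _ = _ := by ring
  -- assemble along the derivative of (2.34)
  rw [derivG_apply_eq P ha hm hk1 μ x x']
  calc |P.eps * (deriv P 0 1 μ * G0unit P a msq) x x' +
        ∑ j ∈ Finset.Ico 1 k, B1.aSeq a P.L j ^ 2 * P.spacing j *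
          ∑ y : Site P j, ∑ y' : Site P j,
            K1 P a msq j μ x ⟨j, y⟩ * Crs P a msq j y y' * (Qk P j * Grs P a msq j) y' x'|
      ≤ |P.eps * (deriv P 0 1 μ * G0unit P a msq) x x'| +
        ∑ j ∈ Finset.Ico 1 k, |B1.aSeq a P.L j ^ 2 * P.spacing j *
          ∑ y : Site P j, ∑ y' : Site P j,
            K1 P a msq j μ x ⟨j, y⟩ * Crs P a msq j y y' * (Qk P j * Grs P a msq j) y' x'| :=
        (abs_add_le _ _).trans (add_le_add le_rfl (Finset.abs_sum_le_sum_abs _ _))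
    _ ≤ 2 * C₀ * Real.exp δ₀ * ((q.factorial : ℝ) / (δ₀ / 2) ^ q) * (P.eps * n⁻¹ ^ q * E) +
        a ^ 2 * (C ^ 3 * B4Sect5Proof.latticeConst P.d (δ / 2) ^ 2 * Real.exp (2 * (δ / 2))) * Cs *
            (P.eps * n⁻¹ ^ q * E) := add_le_add h0 hsum
    _ = _ := by rw [hCs]; ring

/-! ## 4. Hypothesis-free, uniformly in the volume and the scale -/

/-- kernel: the scale-sum constant `C_s(L, θ, p) = L/(L−1)·e^{θ/2} + p!(θ/2)^{−p}(1 − e^{−(θ/2)(L−1)})^{−1}` is nonnegative (`L > 1`,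
`θ > 0`). [folklore] -/
private theorem scaleConst_nonneg {L θ : ℝ} (hL : 1 < L) (hθ : 0 < θ) (p : ℕ) :
    0 ≤ L / (L - 1) * Real.exp (θ / 2) + (p.factorial : ℝ) / (θ / 2) ^ p * (1 - Real.exp (-(θ / 2 * (L - 1))))⁻¹ := by
  have hL0 : 0 < L - 1 := by linarith
  have hq : 0 < 1 - Real.exp (-(θ / 2 * (L - 1))) := by
    have : Real.exp (-(θ / 2 * (L - 1))) < 1 := Real.exp_lt_one_iff.2 (by nlinarith)
    linarith
  positivity

/-- **[Balaban1983Higgs3] p. 437, «|G^ξ_{j″}(0; y, y′)| ≦ O(1)e^{−δ₀|y−y′|}/|y − y′|» AND «the corresponding inequalities for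
derivatives», FOR THE ZERO-FIELD PROPAGATOR ON THE TORUS — HYPOTHESIS-FREE AND UNIFORM.**  For `d ≥ 3`, odd `L > 1`, `a > 0`,
`m² ≥ 0` there are `δ₁ > 0`, `c₁ > 0` (functions of `d, L, a, m²` only) such that for EVERY volume `P = (d, L, m, K)` of Bałaban's
scalar torus tower, every scale `1 ≤ k ≤ K` (`G^ε_k = G_k(T_ε, 0)`), and all fine sites `x′ ≠ x` (`|x−x′|_T` = the sup torus
distance in fine lattice units, `ε = L^{−K}`):
`|G^ε_k(x,x′)| ≤ c₁·ε²·|x−x′|_T^{−(d−2)}·e^{−δ₁ε|x−x′|_T}` and `|(∂^ε_μG^ε_k)(x,x′)| ≤ c₁·ε·|x−x′|_T^{−(d−1)}·e^{−δ₁ε|x−x′|_T}`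
— the sum over the scales of the entry bounds of the (2.34) terms ((2.6)/(2.10) of B3), §3, with the kernel inputs discharged by
p38's `kerBounds_torus` and p37/p16's `G0unit_decay`, and `L^{k−1}ε ≤ 1`. [cite: Balaban1983Higgs3, p.437 [PDF 27], (2.6) p.424,
(2.10) p.426; Balaban1983RegularityDecay, Theorem (1.10) p.573, (2.34)–(2.39) p.582; Balaban1982Higgs1, Prop. 2.1 p.610] -/
theorem gk_zero_torus_pointwise (d L : ℕ) (hd : 3 ≤ d) (hL : Odd L ∧ 1 < L) {a : ℝ} (ha : 0 < a) {msq : ℝ}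
    (hmsq : 0 ≤ msq) :
    ∃ δ₁ c₁ : ℝ, 0 < δ₁ ∧ 0 < c₁ ∧ ∀ (P : Params), P.d = d → P.L = L →
      ∀ k : ℕ, 1 ≤ k → k ≤ P.K → ∀ (x x' : Site P 0), x' ≠ x →
        |(tower P a msq).G k x x'| ≤
            c₁ * P.eps ^ 2 * (T P 0 x x')⁻¹ ^ (d - 2) * Real.exp (-(δ₁ * (P.eps * T P 0 x x'))) ∧
          ∀ μ : Fin P.d, |(deriv P 0 P.eps μ * (tower P a msq).G k) x x'| ≤
            c₁ * P.eps * (T P 0 x x')⁻¹ ^ (d - 1) * Real.exp (-(δ₁ * (P.eps * T P 0 x x'))) := by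
  obtain ⟨C, δ, hC, hδ, hK⟩ := kerBounds_torus d L (by omega) hL ha msq
  -- the j = 0 constants depend on d, L, a, m² only; read them off any volume with these d, L
  obtain ⟨P₀, hP₀d, hP₀L⟩ : ∃ P₀ : Params, P₀.d = d ∧ P₀.L = L := ⟨⟨d, L, 0, 0, by omega, hL⟩, rfl, rfl⟩
  set C₀ := 2 / gamma0 L a with hC₀def
  set δ₀ := dK0 d L a msq with hδ₀def
  have hC₀ : 0 ≤ C₀ := by
    rw [hC₀def, ← hP₀L]; exact (div_pos two_pos (gamma0_pos (P := P₀) ha)).le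
  have hδ₀ : 0 < δ₀ := by rw [hδ₀def, ← hP₀d, ← hP₀L]; exact dK0_pos (P := P₀) ha hmsq
  have hL1 : (1 : ℝ) < L := by exact_mod_cast hL.2
  have hKc : 0 ≤ B4Sect5Proof.latticeConst d (δ / 2) := B4Sect5Proof.latticeConst_nonneg _ (by positivity)
  -- the constants of §3 at dimension d, step L
  set cval : ℝ := C₀ * (((d - 2).factorial : ℝ) / (δ₀ / 2) ^ (d - 2)) +
      a ^ 2 * (C ^ 3 * B4Sect5Proof.latticeConst d (δ / 2) ^ 2 * Real.exp (2 * (δ / 2))) *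
        ((L : ℝ) / ((L : ℝ) - 1) * Real.exp (δ / 2 / 2) +
          ((d - 2).factorial : ℝ) / (δ / 2 / 2) ^ (d - 2) * (1 - Real.exp (-(δ / 2 / 2 * ((L : ℝ) - 1))))⁻¹)
    with hcval
  set cder : ℝ := 2 * C₀ * Real.exp δ₀ * (((d - 1).factorial : ℝ) / (δ₀ / 2) ^ (d - 1)) +
      a ^ 2 * (C ^ 3 * B4Sect5Proof.latticeConst d (δ / 2) ^ 2 * Real.exp (2 * (δ / 2))) *
        ((L : ℝ) / ((L : ℝ) - 1) * Real.exp (δ / 2 / 2) +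
          ((d - 1).factorial : ℝ) / (δ / 2 / 2) ^ (d - 1) * (1 - Real.exp (-(δ / 2 / 2 * ((L : ℝ) - 1))))⁻¹)
    with hcder
  have hCs2 := scaleConst_nonneg hL1 (show 0 < δ / 2 by positivity) (d - 2)
  have hCs1 := scaleConst_nonneg hL1 (show 0 < δ / 2 by positivity) (d - 1)
  have hcval0 : 0 ≤ cval := by rw [hcval]; positivity
  have hcder0 : 0 ≤ cder := by rw [hcder]; positivity
  refine ⟨min (δ₀ / 2) (δ / 4), cval + cder + 1, lt_min (by positivity) (by positivity), by positivity, ?_⟩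
  intro P hPd hPL k hk1 hkK x x' hne
  have hkm : k ≤ P.m + P.K := hkK.trans (Nat.le_add_left _ _)
  have hcap : P.spacing k ^ 2 * msq ≤ msq := by
    have hs1 : P.spacing k ≤ 1 := by rw [← P.spacing_K]; exact spacing_le_spacing P hkK
    have hs0 := (P.spacing_pos k).le
    calc P.spacing k ^ 2 * msq ≤ 1 * msq := mul_le_mul_of_nonneg_right (pow_le_one₀ hs0 hs1) hmsq
      _ = msq := one_mul _
  have hKB := hK P hPd hPL msq hmsq k hkm hcap
  subst hPd hPL
  have hG0 : ∀ x x' : Site P 0, |G0unit P a msq x x'| ≤ C₀ * Real.exp (-(δ₀ * T P 0 x x')) :=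
    fun x x' => G0unit_decay (P := P) ha hmsq x x'
  have hn : 0 < T P 0 x x' := T_pos_of_ne P hne
  have hε0 : 0 < P.eps := P.eps_pos
  obtain ⟨-, hwin2⟩ := scale_window P hkK hn.le
  have hm₁0 : 0 ≤ min (δ₀ / 2) (δ / 4) := le_min (by positivity) (by positivity)
  have hE : Real.exp (-(min (δ₀ / 2) (δ / 4) * (T P 0 x x' / (P.L : ℝ) ^ (k - 1)))) ≤
      Real.exp (-(min (δ₀ / 2) (δ / 4) * (P.eps * T P 0 x x'))) :=
    Real.exp_le_exp.mpr (by nlinarith [mul_le_mul_of_nonneg_left hwin2 hm₁0])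
  constructor
  · have hv := abs_G_entry_le P ha hmsq hd hk1 hkK hkm hC hδ hC₀ hδ₀ hKB hG0 hne
    calc |(tower P a msq).G k x x'|
        ≤ cval * (P.eps ^ 2 * (T P 0 x x')⁻¹ ^ (P.d - 2) *
            Real.exp (-(min (δ₀ / 2) (δ / 4) * (T P 0 x x' / (P.L : ℝ) ^ (k - 1))))) := hv
      _ ≤ (cval + cder + 1) * (P.eps ^ 2 * (T P 0 x x')⁻¹ ^ (P.d - 2) *
            Real.exp (-(min (δ₀ / 2) (δ / 4) * (P.eps * T P 0 x x')))) := by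
          refine mul_le_mul (by linarith) (mul_le_mul_of_nonneg_left hE (by positivity)) (by positivity) (by positivity)
      _ = _ := by ring
  · intro μ
    have hder := abs_derivG_entry_le P ha hmsq (by omega) hk1 hkK hkm hC hδ hC₀ hδ₀ hKB hG0 μ hne
    calc |(deriv P 0 P.eps μ * (tower P a msq).G k) x x'|
        ≤ cder * (P.eps * (T P 0 x x')⁻¹ ^ (P.d - 1) *
            Real.exp (-(min (δ₀ / 2) (δ / 4) * (T P 0 x x' / (P.L : ℝ) ^ (k - 1))))) := hder
      _ ≤ (cval + cder + 1) * (P.eps * (T P 0 x x')⁻¹ ^ (P.d - 1) *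
            Real.exp (-(min (δ₀ / 2) (δ / 4) * (P.eps * T P 0 x x')))) := by
          refine mul_le_mul (by linarith) (mul_le_mul_of_nonneg_left hE (by positivity)) (by positivity) (by positivity)
      _ = _ := by ring

/-- **The same in the print's `η^d`-NORMALISATION** (`G^η_k(x,x′) = ε^{−d}G^ε_k(x,x′)`, so that `(G_kf)(x) = Σ_{x′}ε^dG^η_k(x,x′)f(x′)`;
`dist = ε|x−x′|_T` the `η`-scaled torus distance): for `d ≥ 3`, odd `L > 1`, `a > 0`, `m² ≥ 0` there are `δ₁, c₁ > 0` with
`|G^η_k(x,x′)| ≤ c₁·dist^{−(d−2)}·e^{−δ₁dist}` and `|(∂^ε_μG^η_k)(x,x′)| ≤ c₁·dist^{−(d−1)}·e^{−δ₁dist}` for every volume, every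
`1 ≤ k ≤ K` and all `x′ ≠ x` — at `d = 3` exactly the printed `O(1)e^{−δ₀|y−y′|}/|y−y′|` and, for the derivative, `O(1)e^{−δ₀|y−y′|}/|y−y′|²`.
[cite: Balaban1983Higgs3, p.437 [PDF 27]; Balaban1983RegularityDecay, (2.34)–(2.39) p.582] -/
theorem gk_zero_torus_pointwise_eta (d L : ℕ) (hd : 3 ≤ d) (hL : Odd L ∧ 1 < L) {a : ℝ} (ha : 0 < a) {msq : ℝ}
    (hmsq : 0 ≤ msq) :
    ∃ δ₁ c₁ : ℝ, 0 < δ₁ ∧ 0 < c₁ ∧ ∀ (P : Params), P.d = d → P.L = L →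
      ∀ k : ℕ, 1 ≤ k → k ≤ P.K → ∀ (x x' : Site P 0), x' ≠ x →
        |(P.eps ^ P.d)⁻¹ * (tower P a msq).G k x x'| ≤
            c₁ * (P.eps * T P 0 x x')⁻¹ ^ (d - 2) * Real.exp (-(δ₁ * (P.eps * T P 0 x x'))) ∧
          ∀ μ : Fin P.d, |(P.eps ^ P.d)⁻¹ * (deriv P 0 P.eps μ * (tower P a msq).G k) x x'| ≤
            c₁ * (P.eps * T P 0 x x')⁻¹ ^ (d - 1) * Real.exp (-(δ₁ * (P.eps * T P 0 x x'))) := by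
  obtain ⟨δ₁, c₁, hδ₁, hc₁, H⟩ := gk_zero_torus_pointwise d L hd hL ha hmsq
  refine ⟨δ₁, c₁, hδ₁, hc₁, fun P hPd hPL k hk1 hkK x x' hne => ?_⟩
  obtain ⟨hv, hder⟩ := H P hPd hPL k hk1 hkK x x' hne
  have hε0 : 0 < P.eps := P.eps_pos
  have hεd : 0 < P.eps ^ P.d := pow_pos hε0 _
  subst hPd
  have hsplit2 : P.eps ^ P.d = P.eps ^ (P.d - 2) * P.eps ^ 2 := by rw [← pow_add]; congr 1; omega
  have hsplit1 : P.eps ^ P.d = P.eps ^ (P.d - 1) * P.eps := by rw [← pow_succ]; congr 1; omega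
  constructor
  · rw [abs_mul, abs_of_pos (inv_pos.mpr hεd)]
    calc (P.eps ^ P.d)⁻¹ * |(tower P a msq).G k x x'|
        ≤ (P.eps ^ P.d)⁻¹ * (c₁ * P.eps ^ 2 * (T P 0 x x')⁻¹ ^ (P.d - 2) * Real.exp (-(δ₁ * (P.eps * T P 0 x x')))) :=
          mul_le_mul_of_nonneg_left hv (by positivity)
      _ = c₁ * ((P.eps ^ (P.d - 2))⁻¹ * (T P 0 x x')⁻¹ ^ (P.d - 2)) * Real.exp (-(δ₁ * (P.eps * T P 0 x x'))) *
            ((P.eps ^ 2)⁻¹ * P.eps ^ 2) := by rw [hsplit2, mul_inv]; ring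
      _ = c₁ * (P.eps * T P 0 x x')⁻¹ ^ (P.d - 2) * Real.exp (-(δ₁ * (P.eps * T P 0 x x'))) := by
          rw [inv_mul_cancel₀ (pow_ne_zero 2 hε0.ne'), mul_one, ← inv_pow, mul_inv, mul_pow]
  · intro μ
    rw [abs_mul, abs_of_pos (inv_pos.mpr hεd)]
    calc (P.eps ^ P.d)⁻¹ * |(deriv P 0 P.eps μ * (tower P a msq).G k) x x'|
        ≤ (P.eps ^ P.d)⁻¹ * (c₁ * P.eps * (T P 0 x x')⁻¹ ^ (P.d - 1) * Real.exp (-(δ₁ * (P.eps * T P 0 x x')))) :=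
          mul_le_mul_of_nonneg_left (hder μ) (by positivity)
      _ = c₁ * ((P.eps ^ (P.d - 1))⁻¹ * (T P 0 x x')⁻¹ ^ (P.d - 1)) * Real.exp (-(δ₁ * (P.eps * T P 0 x x'))) *
            (P.eps⁻¹ * P.eps) := by rw [hsplit1, mul_inv]; ring
      _ = c₁ * (P.eps * T P 0 x x')⁻¹ ^ (P.d - 1) * Real.exp (-(δ₁ * (P.eps * T P 0 x x'))) := by
          rw [inv_mul_cancel₀ hε0.ne', mul_one, ← inv_pow, mul_inv, mul_pow]

end

end Literature.MathematicalPhysics.QuantumFieldTheory.Balaban1983to89.B3GkZeroTorusPointwise
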